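import Summits.BirchSwinnertonDyer.BirchSwinnertonDyer.Theorems.Rank1ResidualJetCarrierMultEndFormNamedPrint
import Summits.BirchSwinnertonDyer.BirchSwinnertonDyer.Theorems.Rank1ResidualJetCarrierNeAddEndFormNamedPrint
import Summits.BirchSwinnertonDyer.BirchSwinnertonDyer.Theorems.Rank1ResidualJetKolyvaginClassStringentKolyvagin
import HarnessLib

/-!
# T1 JET (cell `bsd-jet`), road K — END FORMS «named print ONLY» for K3 / K1 / K4: the last kernel gap
# `h49str` (Jetchev's Prop. 4.9 proper) FED BY NAME from pv-1's carrier theorem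

HONEST FRAMING (programme file §HONESTY, verbatim): «no tranche here proves BSD; ARM L moves the
LITERAL column of an r ≤ 1 census into the kernel-proved-modulo-named-print column.» THEOREMS ONLY
(seat `bsd-jet-pv-2`; `--supports stmt-BirchSwinnertonDyer-14418`, helper); 0 classes move; road-K
DOCUMENTARY end forms. WHAT THIS IS. `jetchevDivisibilityCarrier{Mult,Ne,Add}_of_namedPrint` carry the
named print {`h52`, `hCV`, `h44`, `hPT`, `hGZ` (scoped, guarded)} and ONE closed, frame-guarded kernel gap
`h49str`. pv-1 g7's `JET.localization_kolyvaginClass_mem_stringentFamily_carrier_kolyvagin`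
(`Rank1ResidualJetKolyvaginClassStringentKolyvagin`; Jetchev 2008 Prop. 4.9 proper at the carrier pair,
receptacle route: strong Milne I.3.8 + `E⁰(K̄_v) ∩ E(K_v) = E₀(K_v)` + Gross 6.2 (1) upgraded to the
connected Kummer condition, with `hGZ` in the same Kolyvagin-scoped shape) IS that binder, so here the
three reading binders follow from NAMED PRINT ONLY:
`JetchevDivisibilityCarrier{Mult,Ne,Add}` ⟸ {[McC] Prop. 5.2, [J] Prop. 5.3 (core vertices, K5),
[McC] Prop. 4.4, Poitou–Tate duality for Selmer structures (conjugation form), [GZ86 III (3.1)] in the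
receptacle form at square-free Kolyvagin conductors}. References: [cite: Jetchev2008, Thm. 1.4, Thm. 5.2,
Prop. 4.9, Prop. 5.3] [cite: McCallumLMS1991, Prop. 4.4, Prop. 5.2] [cite: GrossZagier1986, III (3.1)]
[cite: MilneADT2006, Ch. I, Prop. 3.8, Thm. 4.10(b)].
-/

set_option autoImplicit false

noncomputable section

open scoped Classical

open WeierstrassCurve IsDedekindDomain NumberField Field Literature.NumberTheory.EllipticCurves
  Literature.NumberTheory.EllipticCurves.ModularForms Literature.NumberTheory.EllipticCurves.Jetchev2008
  Literature.NumberTheory.GaloisRepresentations Literature.NumberTheory.GaloisCohomology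
  Literature.NumberTheory.GaloisRepresentations.DiscreteGaloisModule
  Summit.BirchSwinnertonDyer.Rank1Residual.X11b Summit.BirchSwinnertonDyer.Rank1Residual.X11b.Three
  Summit.BirchSwinnertonDyer.Rank1Residual.JET.SelmerVocabulary Literature.NumberTheory.Automorphic

namespace Summit.BirchSwinnertonDyer.Rank1Residual.JET

/-- **K3 ⟸ NAMED PRINT ONLY** {h52, hCV, h44, hPT, hGZ (scoped, guarded)}: `h49str` fed by pv-1's
`localization_kolyvaginClass_mem_stringentFamily_carrier_kolyvagin`. [cite: Jetchev2008, Thm. 1.4,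
Thm. 5.2, Prop. 4.9] [cite: McCallumLMS1991, Prop. 5.2] [cite: GrossZagier1986, III (3.1)] -/
theorem jetchevDivisibilityCarrierMult_of_namedPrintOnly
    (h52 : McCallum1991.prop52_exists_conductor_kolyvaginClass_order_eq)
    (hCV : JetchevCoreVertexExistence)
    (h44 : McCallum1991.prop44_localOrder_kolyvaginClass_mul_eq)
    (hPT : ∀ (K : Type) [Field K] [NumberField K], poitouTate_selmerStructure_duality_conj K)
    (hGZ : ∀ (W : WeierstrassCurve ℚ) [W.IsElliptic] [W.IsGloballyMinimal] [NeZero (W.conductorNorm ℤ)]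
      (K : Type) [Field K] [NumberField K], IsImaginaryQuadratic K →
      NumberField.discr K ≠ -3 → NumberField.discr K ≠ -4 →
      SatisfiesHeegnerHypothesis (W.conductorNorm ℤ) K →
      ∀ (p : ℕ) [Fact p.Prime], p ≠ 2 → W.HasSurjectiveModNGaloisRep p →
      ∀ (Dt : ModularParametrizationData W (W.conductorNorm ℤ)) (β : ℤ) (ι : K →+* ℂ)
      [∀ j : ℕ, NumberField (ringClassField K ι j)],
      ∃ n' : ℤ, IsCoprime (p : ℤ) n' ∧ ∀ (m : ℕ), Squarefree m →
        (∀ q ∈ m.primeFactors, Zhang2014.IsKolyvaginPrime (W.conductorNorm ℤ) W K p q) →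
        ∀ (dm : KolyvaginHeegnerData Dt β ι m)
        (γ : ringClassField K ι m ≃ₐ[ℚ] ringClassField K ι m), γ ∈ ringClassGal ι m →
        ∀ v : HeightOneSpectrum (𝓞 K), ¬ (W.baseChange K).HasGoodReductionAt v →
          n' • pointsMap (W.baseChange K) (v.adicCompletion K)
              (dm.toGeomPoints (pointGalHom W (ringClassField K ι m) γ dm.y)) ∈
            E0Receptacle (W.baseChange K) v ∧
          ∀ (ℓ : ℕ), ℓ ∈ m.primeFactors → ∀ (dm' : KolyvaginHeegnerData Dt β ι (m / ℓ))
            (hle : ringClassField K ι (m / ℓ) ≤ ringClassField K ι m),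
            n' • pointsMap (W.baseChange K) (v.adicCompletion K)
                (dm.toGeomPoints (pointGalHom W (ringClassField K ι m) γ
                  (WeierstrassCurve.Affine.Point.map (W' := W)
                    ((RingClassField.inclusion ι hle).restrictScalars ℚ) dm'.y))) ∈
              E0Receptacle (W.baseChange K) v) :
    JetchevDivisibilityCarrierMult :=
  jetchevDivisibilityCarrierMult_of_namedPrint h52 hCV h44 hPT hGZ
    (fun W _ _ _ K _ _ hK hD3 hD4 hH p _ hp2 htower Dt β ι _ n' hcop' hGZ' k _ hn c hc hcK τ _ v₀ _ hv₀N
        ℓ h1 h2 h3 d' q hq ↦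
      localization_kolyvaginClass_mem_stringentFamily_carrier_kolyvagin W K hK hD3 hD4 hH hp2
        (by simpa using htower 1) Dt β ι hcop' hGZ' τ hn hc hcK v₀ hv₀N ℓ h1 h2 h3 d' q hq)

/-- **K1 ⟸ NAMED PRINT ONLY** (carrier a prime `q ∣ N`, `q ≠ p`). [cite: Jetchev2008, Thm. 1.4, Thm. 5.2,
Prop. 4.9] [cite: McCallumLMS1991, Prop. 5.2] [cite: GrossZagier1986, III (3.1)] -/
theorem jetchevDivisibilityCarrierNe_of_namedPrintOnly
    (h52 : McCallum1991.prop52_exists_conductor_kolyvaginClass_order_eq)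
    (hCV : JetchevCoreVertexExistence)
    (h44 : McCallum1991.prop44_localOrder_kolyvaginClass_mul_eq)
    (hPT : ∀ (K : Type) [Field K] [NumberField K], poitouTate_selmerStructure_duality_conj K)
    (hGZ : ∀ (W : WeierstrassCurve ℚ) [W.IsElliptic] [W.IsGloballyMinimal] [NeZero (W.conductorNorm ℤ)]
      (K : Type) [Field K] [NumberField K], IsImaginaryQuadratic K →
      NumberField.discr K ≠ -3 → NumberField.discr K ≠ -4 →
      SatisfiesHeegnerHypothesis (W.conductorNorm ℤ) K →
      ∀ (p : ℕ) [Fact p.Prime], p ≠ 2 → W.HasSurjectiveModNGaloisRep p →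
      ∀ (Dt : ModularParametrizationData W (W.conductorNorm ℤ)) (β : ℤ) (ι : K →+* ℂ)
      [∀ j : ℕ, NumberField (ringClassField K ι j)],
      ∃ n' : ℤ, IsCoprime (p : ℤ) n' ∧ ∀ (m : ℕ), Squarefree m →
        (∀ q ∈ m.primeFactors, Zhang2014.IsKolyvaginPrime (W.conductorNorm ℤ) W K p q) →
        ∀ (dm : KolyvaginHeegnerData Dt β ι m)
        (γ : ringClassField K ι m ≃ₐ[ℚ] ringClassField K ι m), γ ∈ ringClassGal ι m →
        ∀ v : HeightOneSpectrum (𝓞 K), ¬ (W.baseChange K).HasGoodReductionAt v →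
          n' • pointsMap (W.baseChange K) (v.adicCompletion K)
              (dm.toGeomPoints (pointGalHom W (ringClassField K ι m) γ dm.y)) ∈
            E0Receptacle (W.baseChange K) v ∧
          ∀ (ℓ : ℕ), ℓ ∈ m.primeFactors → ∀ (dm' : KolyvaginHeegnerData Dt β ι (m / ℓ))
            (hle : ringClassField K ι (m / ℓ) ≤ ringClassField K ι m),
            n' • pointsMap (W.baseChange K) (v.adicCompletion K)
                (dm.toGeomPoints (pointGalHom W (ringClassField K ι m) γ
                  (WeierstrassCurve.Affine.Point.map (W' := W)
                    ((RingClassField.inclusion ι hle).restrictScalars ℚ) dm'.y))) ∈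
              E0Receptacle (W.baseChange K) v) :
    JetchevDivisibilityCarrierNe :=
  jetchevDivisibilityCarrierNe_of_namedPrint h52 hCV h44 hPT hGZ
    (fun W _ _ _ K _ _ hK hD3 hD4 hH p _ hp2 htower Dt β ι _ n' hcop' hGZ' k _ hn c hc hcK τ _ v₀ _ hv₀N
        ℓ h1 h2 h3 d' q hq ↦
      localization_kolyvaginClass_mem_stringentFamily_carrier_kolyvagin W K hK hD3 hD4 hH hp2
        (by simpa using htower 1) Dt β ι hcop' hGZ' τ hn hc hcK v₀ hv₀N ℓ h1 h2 h3 d' q hq)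

/-- **K4 ⟸ NAMED PRINT ONLY** (additive carrier `p ∣ N`). [cite: Jetchev2008, Thm. 1.4, Thm. 5.2,
Prop. 4.9] [cite: McCallumLMS1991, Prop. 5.2] [cite: GrossZagier1986, III (3.1)] -/
theorem jetchevDivisibilityCarrierAdd_of_namedPrintOnly
    (h52 : McCallum1991.prop52_exists_conductor_kolyvaginClass_order_eq)
    (hCV : JetchevCoreVertexExistence)
    (h44 : McCallum1991.prop44_localOrder_kolyvaginClass_mul_eq)
    (hPT : ∀ (K : Type) [Field K] [NumberField K], poitouTate_selmerStructure_duality_conj K)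
    (hGZ : ∀ (W : WeierstrassCurve ℚ) [W.IsElliptic] [W.IsGloballyMinimal] [NeZero (W.conductorNorm ℤ)]
      (K : Type) [Field K] [NumberField K], IsImaginaryQuadratic K →
      NumberField.discr K ≠ -3 → NumberField.discr K ≠ -4 →
      SatisfiesHeegnerHypothesis (W.conductorNorm ℤ) K →
      ∀ (p : ℕ) [Fact p.Prime], p ≠ 2 → W.HasSurjectiveModNGaloisRep p →
      ∀ (Dt : ModularParametrizationData W (W.conductorNorm ℤ)) (β : ℤ) (ι : K →+* ℂ)
      [∀ j : ℕ, NumberField (ringClassField K ι j)],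
      ∃ n' : ℤ, IsCoprime (p : ℤ) n' ∧ ∀ (m : ℕ), Squarefree m →
        (∀ q ∈ m.primeFactors, Zhang2014.IsKolyvaginPrime (W.conductorNorm ℤ) W K p q) →
        ∀ (dm : KolyvaginHeegnerData Dt β ι m)
        (γ : ringClassField K ι m ≃ₐ[ℚ] ringClassField K ι m), γ ∈ ringClassGal ι m →
        ∀ v : HeightOneSpectrum (𝓞 K), ¬ (W.baseChange K).HasGoodReductionAt v →
          n' • pointsMap (W.baseChange K) (v.adicCompletion K)
              (dm.toGeomPoints (pointGalHom W (ringClassField K ι m) γ dm.y)) ∈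
            E0Receptacle (W.baseChange K) v ∧
          ∀ (ℓ : ℕ), ℓ ∈ m.primeFactors → ∀ (dm' : KolyvaginHeegnerData Dt β ι (m / ℓ))
            (hle : ringClassField K ι (m / ℓ) ≤ ringClassField K ι m),
            n' • pointsMap (W.baseChange K) (v.adicCompletion K)
                (dm.toGeomPoints (pointGalHom W (ringClassField K ι m) γ
                  (WeierstrassCurve.Affine.Point.map (W' := W)
                    ((RingClassField.inclusion ι hle).restrictScalars ℚ) dm'.y))) ∈
              E0Receptacle (W.baseChange K) v) :
    JetchevDivisibilityCarrierAdd :=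
  jetchevDivisibilityCarrierAdd_of_namedPrint h52 hCV h44 hPT hGZ
    (fun W _ _ _ K _ _ hK hD3 hD4 hH p _ hp2 htower Dt β ι _ n' hcop' hGZ' k _ hn c hc hcK τ _ v₀ _ hv₀N
        ℓ h1 h2 h3 d' q hq ↦
      localization_kolyvaginClass_mem_stringentFamily_carrier_kolyvagin W K hK hD3 hD4 hH hp2
        (by simpa using htower 1) Dt β ι hcop' hGZ' τ hn hc hcK v₀ hv₀N ℓ h1 h2 h3 d' q hq)

end Summit.BirchSwinnertonDyer.Rank1Residual.JET

end
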